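import Summits.BirchSwinnertonDyer.BirchSwinnertonDyer.Theses.LeadingTerm

/-!
# Route LeadingTerm — assembly item `Assembly`

`Assembly := Consistency → PinchPrime → SqueezeUBR2 → BirchSwinnertonDyer` is literally the type
of the route's certified deciding theorem `closes` (route file `Theses/LeadingTerm.lean`, rev 6);
this file closes the assembly item stmt-BirchSwinnertonDyer-15624 by that theorem.

Nothing else is here: the mathematics of the deciding theorem (global minimal model, pinch prime
with its canonical cyclotomic height datum and newform, `[T^r]L_p ≠ 0` from `order = r_MW`,
`log_p γ_cyc ≠ 0`, hence `q ≠ 0`, hence `L^(r_MW)(E,1) ≠ 0`, transport along the variable change,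
and the junk-robust comparison with the analytic rank) lives in `closes` itself.
-/

namespace Summit.BirchSwinnertonDyer.BirchSwinnertonDyer.Theorems

/-- The assembly item of route LeadingTerm (stmt-BirchSwinnertonDyer-15624): the cruxes
`Consistency` (leading-term consistency of the archimedean and `p`-adic BSD quotients at the
algebraic rank), `PinchPrime` (one good ordinary prime `p ≥ 5` with `ord_T L_p(f, α_p, T) =
rank_ℤ E(ℚ)`) and `SqueezeUBR2` (no excess rank, `rank_ℤ E(ℚ) ≤ ord_{s=1} L(E,s)`) imply
`BirchSwinnertonDyer`. This is the type of the route's deciding theorem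
`Summit.BirchSwinnertonDyer.BirchSwinnertonDyer.Theses.LeadingTerm.closes`, so the proof is that
theorem. -/
theorem leadingTerm_assembly_proof :
    Summit.BirchSwinnertonDyer.BirchSwinnertonDyer.Theses.LeadingTerm.Assembly := by
  unfold Summit.BirchSwinnertonDyer.BirchSwinnertonDyer.Theses.LeadingTerm.Assembly
  exact Summit.BirchSwinnertonDyer.BirchSwinnertonDyer.Theses.LeadingTerm.closes

end Summit.BirchSwinnertonDyer.BirchSwinnertonDyer.Theorems
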